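import Summits.HodgeConjecture.HodgeConjecture.Theses.AnchorTransport
import Literature.AlgebraicGeometry.Limits.CountableSubfieldFamilyDescent
import Literature.AlgebraicGeometry.HodgeTheory.IsoTransport
import Literature.AlgebraicGeometry.Motives.CurveNet
import HarnessLib

/-!
# Route AnchorTransport — `VariationalHodge` (stmt-HodgeConjecture-1076), line `padic-disc-transport`: stub D (descent to a countable field of definition)

The registered skeleton `Cruxes/VariationalHodge/Lines/padic_disc_transport.lean` (crux-strategist p1,
2026-08-17) of the crux `Theses.AnchorTransport.VariationalHodge` has four stubs D/G/P/S; its stub D is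
`stub_descent : Descent := VariationalHodgeDescended → CurveResidual`: the variational Hodge statement
over smooth irreducible AFFINE CURVE bases (the hypothesis of the tree's unconditional reduction
`Theorems.variationalHodge_of_curveBase`) follows from the same statement for families
`f₀ ⊗_{k,σ} ℂ = (baseChangeHom σ).map f₀` base-changed along `σ : k →+* ℂ` from a COUNTABLE field `k`
(all hypotheses and the conclusion read on the complexification).

This file PROVES stub D, with the two definitions of the skeleton unfolded verbatim (a Theorems file
cannot import a crux workfile): `curveResidual_of_variationalHodgeDescended`. The lead of the line
closes the stub by `theorem stub_descent : Descent := Theorems.curveResidual_of_variationalHodgeDescended`.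

## Proof

1. DESCENT OF THE FAMILY (EGA IV₃ 8.8.2 (ii)): `f : 𝒳 ⟶ S` — proper, over an affine base of finite type —
   is isomorphic, as a family over `ℂ`, to `f₀ ⊗_σ ℂ` for a countable subfield `k ⊆ ℂ` and a `k`-family
   `f₀ : 𝒳₀ ⟶ S₀`: the tree's `Limits.exists_countable_subfield_descent`
   (`Literature/AlgebraicGeometry/Limits/CountableSubfieldFamilyDescent.lean`, over
   `Limits.exists_isPullback_specMap_subalgebra` and `Limits.exists_isPullback_whisker_of_hom_tensorObj`).
2. TRANSPORT ALONG AN ISOMORPHISM OF FAMILIES (`e𝒳 : 𝒳' ≅ 𝒳`, `eS : S' ≅ S`, `f' ≫ eS = e𝒳 ≫ f`),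
   proved here for any such "arrow isomorphism": the fibre of `f'` over `s'` is isomorphic to the fibre
   of `f` over `eS s'` compatibly with the fibre inclusions (`exists_fiberIso_of_arrowIso`); smooth
   projective families (`IsSmoothProjectiveFamily.of_arrowIso`), the fibrewise rationality / Hodge-type
   hypotheses, the anchor and the conclusion move across (`IsoTransport`:
   `isRationalClass_map_iff_of_iso`, `isOfHodgeType_map_iff_of_iso`, `mem_algebraicClasses_map_iff_of_iso`;
   `IsoInvariance` of the route is the special case used implicitly); irreducibility, affineness,
   smoothness and dimension of the base move along `eS`.

No new definition, no named fact, no `sorry`; `HC_CM` does not occur.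
-/

noncomputable section

-- every declaration of this problem lives in `Summit.HodgeConjecture.HodgeConjecture.…` (summit = sub-problem)
set_option linter.dupNamespace false

open CategoryTheory CategoryTheory.Limits AlgebraicGeometry TopologicalSpace
open Literature.AlgebraicGeometry.Motives Literature.AlgebraicGeometry.HodgeTheory
open Literature.AlgebraicGeometry.Limits
open Summit.HodgeConjecture.HodgeConjecture.Theses.AnchorTransport

universe u

namespace Summit.HodgeConjecture.HodgeConjecture.Theorems

/-! ### Fibres of isomorphic families -/

section ArrowIso

variable {k : Type u} [Field k] {𝒳 S 𝒳' S' : SchemeOver k} {f : 𝒳 ⟶ S} {f' : 𝒳' ⟶ S'}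
  (e𝒳 : 𝒳' ≅ 𝒳) (eS : S' ≅ S) (comm : f' ≫ eS.hom = e𝒳.hom ≫ f)

include comm in
/-- The underlying scheme morphisms of an isomorphism of families: `f' = e𝒳 ≫ f ≫ eS⁻¹`. [folklore] -/
theorem left_eq_of_arrowIso : f'.left = e𝒳.hom.left ≫ f.left ≫ eS.inv.left := by
  have h := congrArg (fun φ => (φ ≫ eS.inv).left) comm
  simpa using h

include comm in
/-- **Fibres of isomorphic families are isomorphic, compatibly with the fibre inclusions.** For an
isomorphism of families `(e𝒳, eS) : f' ≅ f` over `k` and points `s' ∈ S'(k)`, `s = eS(s') ∈ S(k)`,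
there is an isomorphism `φ : 𝒳'_{s'} ≅ 𝒳_s` of `k`-schemes with `φ ≫ (𝒳_s ↪ 𝒳) = (𝒳'_{s'} ↪ 𝒳') ≫ e𝒳`
(both fibres are the fibre product of `f` along `Spec k → S`). [folklore] -/
theorem exists_fiberIso_of_arrowIso {s' : AlgPoints S' k} {s : AlgPoints S k}
    (hs : AlgPoints.map eS.hom s' = s) :
    ∃ φ : fiberOver f' s' ≅ fiberOver f s, φ.hom ≫ fiberι f s = fiberι f' s' ≫ e𝒳.hom := by
  subst hs
  have Q' : IsPullback (fiberι f' s').left (fiberOverToSpec f' s').left f'.left s'.left :=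
    IsPullback.of_hasPullback f'.left s'.left
  have Q₂ : IsPullback (fiberι f (AlgPoints.map eS.hom s')).left
      (fiberOverToSpec f (AlgPoints.map eS.hom s')).left f.left (AlgPoints.map eS.hom s').left :=
    IsPullback.of_hasPullback f.left (AlgPoints.map eS.hom s').left
  have hf' : f'.left ≫ eS.hom.left = e𝒳.hom.left ≫ f.left := by
    have h := congrArg CommaMorphism.left comm
    simpa using h
  have Q : IsPullback ((fiberι f' s').left ≫ e𝒳.hom.left) (fiberOverToSpec f' s').left f.left
      (AlgPoints.map eS.hom s').left := by
    refine Q'.of_iso (Iso.refl _) ((Over.forget _).mapIso e𝒳) (Iso.refl _) ((Over.forget _).mapIso eS)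
      ?_ ?_ ?_ ?_
    · simp
    · simp
    · simpa using hf'
    · change s'.left ≫ eS.hom.left = 𝟙 _ ≫ (s' ≫ eS.hom).left
      simp
  refine ⟨Over.isoMk (Q.isoIsPullback _ _ Q₂) ?_, ?_⟩
  · change (Q.isoIsPullback _ _ Q₂).hom ≫ (fiberι f (AlgPoints.map eS.hom s')).left ≫ 𝒳.hom =
      (fiberι f' s').left ≫ 𝒳'.hom
    rw [← Category.assoc, IsPullback.isoIsPullback_hom_fst, Category.assoc, Over.w e𝒳.hom]
  · ext : 1
    change (Q.isoIsPullback _ _ Q₂).hom ≫ (fiberι f (AlgPoints.map eS.hom s')).left =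
      (fiberι f' s').left ≫ e𝒳.hom.left
    exact Q.isoIsPullback_hom_fst _ _ Q₂

include comm in
/-- **Smooth projective families transport along isomorphisms of families**: smoothness of relative
dimension `n` and properness respect isomorphisms, and every fibre of `f'` is isomorphic to a fibre of
`f` (`exists_fiberIso_of_arrowIso`, `IsSmoothProjective.of_iso`). [folklore] -/
theorem IsSmoothProjectiveFamily.of_arrowIso {n : ℕ} (hf : IsSmoothProjectiveFamily f n) :
    IsSmoothProjectiveFamily f' n := by
  have hl := left_eq_of_arrowIso e𝒳 eS comm
  haveI : IsIso e𝒳.hom.left := by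
    change IsIso ((Over.forget _).map e𝒳.hom)
    infer_instance
  haveI : IsIso eS.inv.left := by
    change IsIso ((Over.forget _).map eS.inv)
    infer_instance
  refine ⟨?_, ?_, fun s' => ?_⟩
  · rw [hl]
    exact (MorphismProperty.cancel_left_of_respectsIso (@SmoothOfRelativeDimension n) _ _).mpr
      ((MorphismProperty.cancel_right_of_respectsIso (@SmoothOfRelativeDimension n) _ _).mpr
        hf.smoothOfRelativeDimension)
  · rw [hl]
    exact (MorphismProperty.cancel_left_of_respectsIso (@IsProper) _ _).mpr
      ((MorphismProperty.cancel_right_of_respectsIso (@IsProper) _ _).mpr hf.isProper)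
  · obtain ⟨φ, -⟩ := exists_fiberIso_of_arrowIso e𝒳 eS comm (s' := s') rfl
    exact (hf.isSmoothProjective _).of_iso φ.symm

end ArrowIso

/-! ### Transport of the data of the crux along an isomorphism of complex families -/

section Complex

variable {𝒳 S 𝒳' S' : SchemeOver ℂ} {f : 𝒳 ⟶ S} {f' : 𝒳' ⟶ S'}
  (e𝒳 : 𝒳' ≅ 𝒳) (eS : S' ≅ S)

/-- **Restrictions to the fibres of an isomorphic family**: for `φ : 𝒳'_{s'} ≅ 𝒳_s` compatible with
the fibre inclusions, `(e𝒳^* A)|_{𝒳'_{s'}} = φ^* (A|_{𝒳_s})`. [folklore] -/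
theorem map_fiberι_of_fiberIso {s' : ComplexPoints S'} {s : ComplexPoints S}
    (φ : fiberOver f' s' ≅ fiberOver f s) (hφ : φ.hom ≫ fiberι f s = fiberι f' s' ≫ e𝒳.hom)
    (i : ℕ) (A : complexBetti 𝒳 i) :
    complexBetti.map (fiberι f' s') i (complexBetti.map e𝒳.hom i A) =
      complexBetti.map φ.hom i (complexBetti.map (fiberι f s) i A) := by
  rw [← CategoryTheory.comp_apply, ← complexBetti.map_comp, ← CategoryTheory.comp_apply,
    ← complexBetti.map_comp, hφ]

/-- **The fibrewise hypotheses move along an isomorphism of families**: if every `A|_{𝒳_s}` is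
rational of Hodge type `(p, p)` (fibres of relative dimension `n`), so is every `(e𝒳^* A)|_{𝒳'_{s'}}`
(`isRationalClass_map_iff_of_iso`, `isOfHodgeType_map_iff_of_iso`). [folklore] -/
theorem fibrewise_rational_hodgeType_of_arrowIso (comm : f' ≫ eS.hom = e𝒳.hom ≫ f) {n p : ℕ}
    (A : complexBetti 𝒳 (2 * p))
    (hA : ∀ s : ComplexPoints S, IsRationalClass (complexBetti.map (fiberι f s) (2 * p) A) ∧
      IsOfHodgeType n (fiberOver f s) (2 * p) p p (complexBetti.map (fiberι f s) (2 * p) A))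
    (s' : ComplexPoints S') :
    IsRationalClass (complexBetti.map (fiberι f' s') (2 * p) (complexBetti.map e𝒳.hom (2 * p) A)) ∧
      IsOfHodgeType n (fiberOver f' s') (2 * p) p p
        (complexBetti.map (fiberι f' s') (2 * p) (complexBetti.map e𝒳.hom (2 * p) A)) := by
  obtain ⟨φ, hφ⟩ := exists_fiberIso_of_arrowIso e𝒳 eS comm (s' := s') rfl
  rw [map_fiberι_of_fiberIso e𝒳 φ hφ]
  exact ⟨(isRationalClass_map_iff_of_iso φ).mpr (hA _).1,
    (isOfHodgeType_map_iff_of_iso φ).mpr (hA _).2⟩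

/-- **Algebraicity of the restrictions is invariant along an isomorphism of families**:
`(e𝒳^* A)|_{𝒳'_{s'}}` is algebraic iff `A|_{𝒳_{eS s'}}` is (`mem_algebraicClasses_map_iff_of_iso`
along the isomorphism of fibres). [folklore] -/
theorem map_fiberι_mem_algebraicClasses_iff_of_arrowIso (comm : f' ≫ eS.hom = e𝒳.hom ≫ f) {p : ℕ}
    (A : complexBetti 𝒳 (2 * p)) {s' : ComplexPoints S'} {s : ComplexPoints S}
    (hs : AlgPoints.map eS.hom s' = s) :
    complexBetti.map (fiberι f' s') (2 * p) (complexBetti.map e𝒳.hom (2 * p) A) ∈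
        algebraicClasses (fiberOver f' s') p ↔
      complexBetti.map (fiberι f s) (2 * p) A ∈ algebraicClasses (fiberOver f s) p := by
  obtain ⟨φ, hφ⟩ := exists_fiberIso_of_arrowIso e𝒳 eS comm hs
  rw [map_fiberι_of_fiberIso e𝒳 φ hφ]
  exact mem_algebraicClasses_map_iff_of_iso φ

include eS in
/-- **The hypotheses on the base move along an isomorphism of bases**: irreducibility, affineness,
smoothness over `ℂ` and topological Krull dimension are invariant under `eS : S' ≅ S`. [folklore] -/
theorem base_hypotheses_of_iso [IrreducibleSpace S.left] [IsAffine S.left]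
    [AlgebraicGeometry.Smooth S.hom] (hdim : topologicalKrullDim S.left = 1) :
    IrreducibleSpace S'.left ∧ IsAffine S'.left ∧ AlgebraicGeometry.Smooth S'.hom ∧
      topologicalKrullDim S'.left = 1 := by
  haveI : IsIso eS.hom.left := by
    change IsIso ((Over.forget _).map eS.hom)
    infer_instance
  let h : S'.left ≃ₜ S.left := Scheme.homeoOfIso (asIso eS.hom.left)
  refine ⟨h.irreducibleSpace_iff.mpr inferInstance, IsAffine.of_isIso eS.hom.left, ?_, ?_⟩
  · rw [← Over.w eS.hom]
    exact (MorphismProperty.cancel_left_of_respectsIso (@AlgebraicGeometry.Smooth) _ _).mpr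
      inferInstance
  · rw [IsHomeomorph.topologicalKrullDim_eq _ h.isHomeomorph, hdim]

end Complex

/-! ### Stub D: the curve residual of the crux follows from its descended form -/

/-- **Stub D (`stub_descent`) of line `padic-disc-transport` of the crux `VariationalHodge`
(stmt-HodgeConjecture-1076).** The variational Hodge statement over smooth irreducible affine curve
bases (`CurveResidual` of the skeleton, unfolded) follows from its DESCENDED form
(`VariationalHodgeDescended`, unfolded): the same statement for families `(baseChangeHom σ).map f₀`
base-changed along `σ : k →+* ℂ` from a COUNTABLE field `k`. Proof: descend `f` to a countable
subfield (`Limits.exists_countable_subfield_descent`, EGA IV₃ 8.8.2 (ii)), transport the hypotheses to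
the isomorphic family `f₀ ⊗_σ ℂ` and the conclusion back (`§ArrowIso`, `§Complex`).
[cite: EGAIV3, Thm. 8.8.2 (ii)] -/
theorem curveResidual_of_variationalHodgeDescended
    (hD : ∀ (k : Type) [Field k] [Countable k] (σ : k →+* ℂ) ⦃n : ℕ⦄ ⦃𝒳₀ S₀ : SchemeOver k⦄
      (f₀ : 𝒳₀ ⟶ S₀),
      IsSmoothProjectiveFamily ((baseChangeHom σ).map f₀) n →
      IrreducibleSpace ((baseChangeHom σ).obj S₀).left → IsAffine ((baseChangeHom σ).obj S₀).left →
      AlgebraicGeometry.Smooth ((baseChangeHom σ).obj S₀).hom →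
      topologicalKrullDim ((baseChangeHom σ).obj S₀).left = 1 →
      ∀ (p : ℕ) (A : complexBetti ((baseChangeHom σ).obj 𝒳₀) (2 * p)),
      (∀ s : ComplexPoints ((baseChangeHom σ).obj S₀),
        IsRationalClass (complexBetti.map (fiberι ((baseChangeHom σ).map f₀) s) (2 * p) A) ∧
        IsOfHodgeType n (fiberOver ((baseChangeHom σ).map f₀) s) (2 * p) p p
          (complexBetti.map (fiberι ((baseChangeHom σ).map f₀) s) (2 * p) A)) →
      (∃ s₀ : ComplexPoints ((baseChangeHom σ).obj S₀),
        complexBetti.map (fiberι ((baseChangeHom σ).map f₀) s₀) (2 * p) A ∈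
          algebraicClasses (fiberOver ((baseChangeHom σ).map f₀) s₀) p) →
      ∀ s : ComplexPoints ((baseChangeHom σ).obj S₀),
        complexBetti.map (fiberι ((baseChangeHom σ).map f₀) s) (2 * p) A ∈
          algebraicClasses (fiberOver ((baseChangeHom σ).map f₀) s) p) :
    ∀ ⦃n : ℕ⦄ ⦃𝒳 S : SchemeOver ℂ⦄ (f : 𝒳 ⟶ S), IsSmoothProjectiveFamily f n →
      IrreducibleSpace S.left → IsAffine S.left → AlgebraicGeometry.Smooth S.hom →
      topologicalKrullDim S.left = 1 →
      ∀ (p : ℕ) (A : complexBetti 𝒳 (2 * p)),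
      (∀ s : ComplexPoints S, IsRationalClass (complexBetti.map (fiberι f s) (2 * p) A) ∧
        IsOfHodgeType n (fiberOver f s) (2 * p) p p (complexBetti.map (fiberι f s) (2 * p) A)) →
      (∃ s₀ : ComplexPoints S,
        complexBetti.map (fiberι f s₀) (2 * p) A ∈ algebraicClasses (fiberOver f s₀) p) →
      ∀ s : ComplexPoints S,
        complexBetti.map (fiberι f s) (2 * p) A ∈ algebraicClasses (fiberOver f s) p := by
  intro n 𝒳 S f hf hirr haff hsm hdim p A hA hanchor s
  obtain ⟨s₀, hs₀⟩ := hanchor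
  -- instances for the descent: `S → Spec ℂ` affine of finite type, `f` proper
  haveI : IsProper f.left := hf.isProper
  haveI : IsAffineHom S.hom := isAffineHom_of_isAffine S.hom
  haveI : IsSeparated S.hom := inferInstance
  haveI : QuasiCompact S.hom := inferInstance
  haveI : LocallyOfFiniteType S.hom := inferInstance
  -- (1) descent to a countable subfield
  obtain ⟨k, _, _, σ, 𝒳₀, S₀, f₀, e𝒳, eS, hcomm⟩ := exists_countable_subfield_descent f
  -- (2) transport of the hypotheses to `f₀ ⊗_σ ℂ`
  have hf' : IsSmoothProjectiveFamily ((baseChangeHom σ).map f₀) n :=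
    IsSmoothProjectiveFamily.of_arrowIso e𝒳 eS hcomm hf
  obtain ⟨hirr', haff', hsm', hdim'⟩ := base_hypotheses_of_iso (S' := (baseChangeHom σ).obj S₀) eS hdim
  have hA' := fibrewise_rational_hodgeType_of_arrowIso e𝒳 eS hcomm A hA
  have hs₀' : complexBetti.map (fiberι ((baseChangeHom σ).map f₀) (AlgPoints.map eS.inv s₀)) (2 * p)
      (complexBetti.map e𝒳.hom (2 * p) A) ∈
        algebraicClasses (fiberOver ((baseChangeHom σ).map f₀) (AlgPoints.map eS.inv s₀)) p :=
    (map_fiberι_mem_algebraicClasses_iff_of_arrowIso e𝒳 eS hcomm A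
      (AlgPoints.map_hom_map_inv_apply eS s₀)).mpr hs₀
  -- (3) the descended statement and transport of the conclusion back
  have h := hD k σ f₀ hf' hirr' haff' hsm' hdim' p (complexBetti.map e𝒳.hom (2 * p) A) hA'
    ⟨AlgPoints.map eS.inv s₀, hs₀'⟩ (AlgPoints.map eS.inv s)
  exact (map_fiberι_mem_algebraicClasses_iff_of_arrowIso e𝒳 eS hcomm A
    (AlgPoints.map_hom_map_inv_apply eS s)).mp h

end Summit.HodgeConjecture.HodgeConjecture.Theorems

end
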